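import Summits.HodgeConjecture.HodgeConjecture.Theorems.HodgeLocusCensusQuarticCertTwoSum
import Summits.HodgeConjecture.HodgeConjecture.Theorems.HodgeLocusCensusQuarticCertTwoDiff
import Summits.HodgeConjecture.HodgeConjecture.Theorems.HodgeLocusCensusQuarticCertMidSum
import Summits.HodgeConjecture.HodgeConjecture.Theorems.HodgeLocusCensusQuarticCertMidDiff
import Summits.HodgeConjecture.HodgeConjecture.Theorems.HodgeLocusCensusQuarticCertMid2Sum
import Summits.HodgeConjecture.HodgeConjecture.Theorems.HodgeLocusCensusQuarticCertMid2Diff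
import Summits.HodgeConjecture.HodgeConjecture.Theorems.HodgeLocusCensusQuarticStack
import Summits.HodgeConjecture.HodgeConjecture.Theorems.HodgeLocusCensusFiveTuple641
import Literature.AlgebraicGeometry.Kloosterman2023.CompleteIntersectionHodgeLoci
import HarnessLib
import HarnessLib.Audit.Tags

/-!
# HodgeLocusCensusQuarticTwoBlockRows — Movasati's Conjecture 5 fails at (n,d,m) = (6,4,1), the QUARTIC sixfold: typed rows and the kernel-checked refutation (cell pub-hlocus, LEAD seat ivhs-1, gen 6)
HONEST FRAMING: certified instances and evidence bearing on the general Hodge conjecture; no claim.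

[Movasati2016Periods] (arXiv:1602.06607v4, §6 'Sum of two linear cycles') defines H^d_n(m) := rank [p_{i+j}]([P^{n/2}] + [P̌^{n/2}]) for two
linear cycles of the Fermat variety X^d_n meeting in a ℙ^m and states CONJECTURE 5: "The number H^d_n(m) depends only on d, n, m and not the
choice of P^{n/2}, P̌^{n/2}"; the printed five-tuple (n,d,m | H, intdim) = (6,4,1 | 36, 37) is computed there with the STANDARD pair. The cubic
instance (8,3,2) is refuted in `HodgeLocusCensusTwoBlockRows` (seat ivhs-2). This file types the quartic instance (6,4,1) — the first entry of
the table with H < intdim — for two explicit pairs of 3-planes of the Fermat quartic sixfold X⁴₆ ⊂ ℙ⁷ meeting in a LINE, and REFUTES it: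
* standard pair (P0, P̌₁) = (`standardP 6`, `standardPc 6 1 1`): rank 36 for [P0] + [P̌₁] (the census row `fiveTuple_6_4_1`, PROVED in
  `HodgeLocusCensusFiveTuple641`; = `Kloosterman2023.ciLocusCodim [1,1,2,2] 4`, the CI(1,1,2,2) explanation) — one LESS than intdim⁴₆(1) = 37;
* TWO-BLOCK pair (P0, Ptwo), Ptwo = `twoBlockP6` = {x₀=ζx₂, x₁=ζx₃, x₄=ζx₆, x₅=ζx₇} (both coordinate 4-blocks of P0 re-matched, b = (1 2)(5 6),
  sign(b) = +1): rank 37 for [P0] + [Ptwo] (`ivhsRankEq_twoSum`) and 36 for [P0] − [Ptwo] (`ivhsRankEq_twoDiff`);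
* both pairs meet in a ℙ¹ (`inter_P0_twoBlock`, `inter_P0_std`: the two cones intersected, in solved form — 6 pivots, 2 free coordinates), so
  H⁴₆(1) would have to be both 36 and 37: `movasatiConjecture5_at_6_4_1_false` (¬ `movasatiConjecture5_at_6_4_1`, at ζ = e^{2πi/8} ∈ ℂ).
INTDIM. intdim⁴₆(1) = 37 is Movasati's printed codimension of V_{P0} ∩ V_{P̌} [Movasati2016Periods, Thm. 13] (`Kloosterman2023.intdim 6 4 2 = 37`,
cited evaluation `movasati_fiveTuples_intdim`); the two-block row attains it (`explainedSmooth_6_4_1_twoBlock`, `ivhsRankEq_twoSum_intdim`), the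
standard row is one less (the printed anomaly 36 < 37 of the five-tuple). The companion file `HodgeLocusCensusQuarticStackedRows` certifies 37 also as
the rank of the two single-plane period matrices STACKED (codimension of the intersection of the two Zariski tangent spaces) for BOTH pairs.
ORIENTATION. Matrix entries are the schema's normalised periods (`HodgeLocus.Census.period`, MV18 Thm. 1 including sign(b)), so δ = [(1,P0),(1,Ptwo)]
is the class [P0] + [Ptwo]. Independent check of the RELATIVE sign along the chain P0 → P3 → Ptwo (P3 = `midP6`, only the last 4-block re-matched,
sign −1): consecutive planes meet in a ℙ² (`inter_P0_mid`, `inter_mid_twoBlock`, m = 2 = n/2 − 1) and the union of each consecutive pair is a complete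
intersection of type (1,1,1,2) (`union_P0_mid_ci`, `union_mid_twoBlock_ci`); rank([P]+[P′]) = 26 = `Kloosterman2023.ciLocusCodim [1,1,1,2] 4` (the
codimension of the locus of quartic sixfolds containing such a complete intersection [cite Kloosterman2023 Prop. 3.2]; Movasati 2022 Thm. 5 for
m = n/2 − 1; typed `ivhsRankEq_midSum_ci`, `ivhsRankEq_mid2Sum_ci`) for the sum but 29 for the difference at both steps (`ivhsRankEq_midDiff`,
`ivhsRankEq_mid2Diff`). As the Hodge locus of the class of a complete intersection contains the complete-intersection locus, its tangent codimension
(= the rank, [Movasati2016Periods, Thm. 6]) is at most 26 < 29: '+' is the geometric relative sign at each step, hence for (P0, Ptwo). (This paragraph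
is the cited evidence for reading the typed rows geometrically; the typed refutation itself is a statement about the schema's matrices.)
NUMERICS (two-implementation rule): impl. 1 = exact Gaussian elimination over ℚ(ζ₈) by torus-weight blocks (t41/rank64.py: 37 = 2+8+17+8+2,
36, 26 = 1+6+12+6+1, 29, 26, 29; stacked 37, 37) = seat ivhs-2's engines A/B and mod-p checks (HOME/pub-hlocus-ivhs-2/CONJ5-REFUTATION-g7.md, cells
(6,4,1) and (8,4,2)) = impl. 2, the exact rank CERTIFICATES over ℤ[ζ₈] generated by t41/gen64.py and RE-MULTIPLIED BY THE LEAN KERNEL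
(`HodgeLocusCensusQuarticCert*`, `decide +kernel`, soundness `Z8Cert.rank_eq_of_valid`, instance layer `HodgeLocusCensusQuarticDense`).
-/

namespace Summit.HodgeConjecture.HodgeConjecture.HodgeLocus.Census.QuarticTwoBlock

open PlaneSum Z8Cert QDense TwistCells
open Literature.AlgebraicGeometry.Kloosterman2023 (ciLocusCodim intdim codimOne_pair_ciLocusCodim movasati_fiveTuples_intdim
  movasati_fiveTuples_rank_eq_ciLocusCodim)

/-! ## The planes -/

/-- Ptwo: the 3-plane x₀=ζx₂, x₁=ζx₃, x₄=ζx₆, x₅=ζx₇ of the Fermat quartic sixfold — the standard plane with BOTH coordinate 4-blocks {0,1,2,3},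
{4,5,6,7} re-matched (matching b = (1 2)(5 6), sign(b) = +1; no twists). P0 ∩ Ptwo = ℙ¹ (`inter_P0_twoBlock`). -/
def twoBlockP6 : LinearCycle 6 := ⟨fun _ => 0, Equiv.swap 1 2 * Equiv.swap 5 6⟩

/-- P3: the 3-plane x₀=ζx₁, x₂=ζx₃, x₄=ζx₆, x₅=ζx₇ — the standard plane with only the LAST 4-block re-matched (b = (5 6), sign(b) = −1). -/
def midP6 : LinearCycle 6 := ⟨fun _ => 0, Equiv.swap 5 6⟩

section links

variable {K : Type*} [Field K] (ζ : K)

/-- sign of the two-block matching: (1 2)(5 6) is even. -/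
theorem sign_twoBlockP6 : (Equiv.Perm.sign twoBlockP6.b : ℤ) = 1 := by
  simp [twoBlockP6, Equiv.Perm.sign_mul, Equiv.Perm.sign_swap (show (1 : Fin 8) ≠ 2 by decide),
    Equiv.Perm.sign_swap (show (5 : Fin 8) ≠ 6 by decide)]

/-- sign of the one-block matching: (5 6) is odd. -/
theorem sign_midP6 : (Equiv.Perm.sign midP6.b : ℤ) = -1 := by
  simp [midP6, Equiv.Perm.sign_swap (show (5 : Fin 8) ≠ 6 by decide)]

/-- class [P0] ↔ signed-plane list `planeStdL`. -/
theorem periodComb_std (h4 : ζ ^ 4 = -1) (i : Fin 8 → ℕ) :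
    periodComb 6 4 ζ [(1, standardP 6)] i = Z8.eval ζ (entryQ planeStdL (ext8 i)) :=
  link_cons ζ h4 1 1 (by norm_num) (standardP 6) _ (by simp [standardP]) (by decide) (by decide) _ _ (link_nil ζ) i

/-- class [Ptwo] ↔ `planeTwoL`. -/
theorem periodComb_two (h4 : ζ ^ 4 = -1) (i : Fin 8 → ℕ) :
    periodComb 6 4 ζ [(1, twoBlockP6)] i = Z8.eval ζ (entryQ planeTwoL (ext8 i)) :=
  link_cons ζ h4 1 1 (by norm_num) twoBlockP6 _ (by simp [sign_twoBlockP6]) (by decide) (by decide) _ _ (link_nil ζ) i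

/-- class [P̌₁] = [`standardPc 6 1 1`] ↔ `planeStdTwistL`. -/
theorem periodComb_stdTwist (h4 : ζ ^ 4 = -1) (i : Fin 8 → ℕ) :
    periodComb 6 4 ζ [(1, standardPc 6 1 1)] i = Z8.eval ζ (entryQ planeStdTwistL (ext8 i)) :=
  link_cons ζ h4 1 1 (by norm_num) (standardPc 6 1 1) _ (by simp [standardPc]) (by decide) (by decide) _ _ (link_nil ζ) i

/-- class [P0] + [Ptwo] ↔ `twoSumL`. -/
theorem periodComb_twoSum (h4 : ζ ^ 4 = -1) (i : Fin 8 → ℕ) :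
    periodComb 6 4 ζ [(1, standardP 6), (1, twoBlockP6)] i = Z8.eval ζ (entryQ twoSumL (ext8 i)) :=
  link_cons ζ h4 1 1 (by norm_num) (standardP 6) _ (by simp [standardP]) (by decide) (by decide) _ _ (fun i => periodComb_two ζ h4 i) i

/-- class [P0] − [Ptwo] ↔ `twoDiffL`. -/
theorem periodComb_twoDiff (h4 : ζ ^ 4 = -1) (i : Fin 8 → ℕ) :
    periodComb 6 4 ζ [(1, standardP 6), (-1, twoBlockP6)] i = Z8.eval ζ (entryQ twoDiffL (ext8 i)) :=
  link_cons ζ h4 1 1 (by norm_num) (standardP 6) _ (by simp [standardP]) (by decide) (by decide) _ _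
    (link_cons ζ h4 (-1) (-1) (by norm_num) twoBlockP6 _ (by simp [sign_twoBlockP6]) (by decide) (by decide) _ _ (link_nil ζ)) i

/-- class [P0] + [P3] ↔ `midSumL`. -/
theorem periodComb_midSum (h4 : ζ ^ 4 = -1) (i : Fin 8 → ℕ) :
    periodComb 6 4 ζ [(1, standardP 6), (1, midP6)] i = Z8.eval ζ (entryQ midSumL (ext8 i)) :=
  link_cons ζ h4 1 1 (by norm_num) (standardP 6) _ (by simp [standardP]) (by decide) (by decide) _ _
    (link_cons ζ h4 1 1 (by norm_num) midP6 _ (by simp [sign_midP6]) (by decide) (by decide) _ _ (link_nil ζ)) i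

/-- class [P0] − [P3] ↔ `midDiffL`. -/
theorem periodComb_midDiff (h4 : ζ ^ 4 = -1) (i : Fin 8 → ℕ) :
    periodComb 6 4 ζ [(1, standardP 6), (-1, midP6)] i = Z8.eval ζ (entryQ midDiffL (ext8 i)) :=
  link_cons ζ h4 1 1 (by norm_num) (standardP 6) _ (by simp [standardP]) (by decide) (by decide) _ _
    (link_cons ζ h4 (-1) (-1) (by norm_num) midP6 _ (by simp [sign_midP6]) (by decide) (by decide) _ _ (link_nil ζ)) i

/-- class [P3] + [Ptwo] ↔ `mid2SumL`. -/
theorem periodComb_mid2Sum (h4 : ζ ^ 4 = -1) (i : Fin 8 → ℕ) :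
    periodComb 6 4 ζ [(1, midP6), (1, twoBlockP6)] i = Z8.eval ζ (entryQ mid2SumL (ext8 i)) :=
  link_cons ζ h4 1 1 (by norm_num) midP6 _ (by simp [sign_midP6]) (by decide) (by decide) _ _ (fun i => periodComb_two ζ h4 i) i

/-- class [P3] − [Ptwo] ↔ `mid2DiffL`. -/
theorem periodComb_mid2Diff (h4 : ζ ^ 4 = -1) (i : Fin 8 → ℕ) :
    periodComb 6 4 ζ [(1, midP6), (-1, twoBlockP6)] i = Z8.eval ζ (entryQ mid2DiffL (ext8 i)) :=
  link_cons ζ h4 1 1 (by norm_num) midP6 _ (by simp [sign_midP6]) (by decide) (by decide) _ _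
    (link_cons ζ h4 (-1) (-1) (by norm_num) twoBlockP6 _ (by simp [sign_twoBlockP6]) (by decide) (by decide) _ _ (link_nil ζ)) i

end links

/-! ## The typed rows (rank of [p_{i+j}(δ)] over every characteristic-0 field with a primitive 8th root of unity) -/

/-- (6,4 | two-block pair, m = 1): rank [p_{i+j}]([P0] + [Ptwo]) = 37. -/
theorem ivhsRankEq_twoSum : IvhsRankEq 6 4 37 [(1, standardP 6), (1, twoBlockP6)] :=
  ivhsRankEq_of_qcert twoSumL (by decide) _ (fun _ _ ζ h4 i => periodComb_twoSum ζ h4 i) twoSumCert twoSum_valid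

/-- (6,4 | two-block pair, m = 1): rank [p_{i+j}]([P0] − [Ptwo]) = 36. -/
theorem ivhsRankEq_twoDiff : IvhsRankEq 6 4 36 [(1, standardP 6), (-1, twoBlockP6)] :=
  ivhsRankEq_of_qcert twoDiffL (by decide) _ (fun _ _ ζ h4 i => periodComb_twoDiff ζ h4 i) twoDiffCert twoDiff_valid

/-- (6,4 | standard pair, m = 1): rank [p_{i+j}]([P0] + [P̌₁]) = 36 — the census row `fiveTuple_6_4_1`, proved in `HodgeLocusCensusFiveTuple641`,
restated for side-by-side reading (the −1 row, rank 36 too, is `explainedSmooth_6_4_1_difference_holds` in `HodgeLocusCensusQuarticRowsPlaneSum`). -/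
theorem ivhsRankEq_stdSum : IvhsRankEq 6 4 36 [(1, standardP 6), (1, standardPc 6 1 1)] := by
  have h := FiveTuple641.fiveTuple_6_4_1_holds
  unfold fiveTuple_6_4_1 at h
  exact h

/-- chain step 1, sum: rank [p_{i+j}]([P0] + [P3]) = 26. -/
theorem ivhsRankEq_midSum : IvhsRankEq 6 4 26 [(1, standardP 6), (1, midP6)] :=
  ivhsRankEq_of_qcert midSumL (by decide) _ (fun _ _ ζ h4 i => periodComb_midSum ζ h4 i) midSumCert midSum_valid

/-- chain step 1, difference: rank [p_{i+j}]([P0] − [P3]) = 29. -/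
theorem ivhsRankEq_midDiff : IvhsRankEq 6 4 29 [(1, standardP 6), (-1, midP6)] :=
  ivhsRankEq_of_qcert midDiffL (by decide) _ (fun _ _ ζ h4 i => periodComb_midDiff ζ h4 i) midDiffCert midDiff_valid

/-- chain step 2, sum: rank [p_{i+j}]([P3] + [Ptwo]) = 26. -/
theorem ivhsRankEq_mid2Sum : IvhsRankEq 6 4 26 [(1, midP6), (1, twoBlockP6)] :=
  ivhsRankEq_of_qcert mid2SumL (by decide) _ (fun _ _ ζ h4 i => periodComb_mid2Sum ζ h4 i) mid2SumCert mid2Sum_valid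

/-- chain step 2, difference: rank [p_{i+j}]([P3] − [Ptwo]) = 29. -/
theorem ivhsRankEq_mid2Diff : IvhsRankEq 6 4 29 [(1, midP6), (-1, twoBlockP6)] :=
  ivhsRankEq_of_qcert mid2DiffL (by decide) _ (fun _ _ ζ h4 i => periodComb_mid2Diff ζ h4 i) mid2DiffCert mid2Diff_valid

/-- the chain value 26 is Kloosterman's h_I(4) for CI(1,1,1,2) in quartic sixfolds (`codimOne_pair_ciLocusCodim`, a cited Literature evaluation). -/
theorem ciLocusCodim_1112_quartic : ciLocusCodim [1, 1, 1, 2] 4 = 26 :=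
  codimOne_pair_ciLocusCodim.2.2.2.2.2.2.2.2.1

/-- chain step 1 in invariant form: rank [p_{i+j}]([P0] + [P3]) = codim of the locus of quartic sixfolds containing a CI of type (1,1,1,2). -/
theorem ivhsRankEq_midSum_ci : IvhsRankEq 6 4 (ciLocusCodim [1, 1, 1, 2] 4) [(1, standardP 6), (1, midP6)] := by
  rw [ciLocusCodim_1112_quartic]; exact ivhsRankEq_midSum

/-- chain step 2 in invariant form. -/
theorem ivhsRankEq_mid2Sum_ci : IvhsRankEq 6 4 (ciLocusCodim [1, 1, 1, 2] 4) [(1, midP6), (1, twoBlockP6)] := by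
  rw [ciLocusCodim_1112_quartic]; exact ivhsRankEq_mid2Sum

/-- the standard value 36 is Kloosterman's h_I(4) for CI(1,1,2,2) (`movasati_fiveTuples_rank_eq_ciLocusCodim`, cited): the standard row in invariant form. -/
theorem ivhsRankEq_stdSum_ci : IvhsRankEq 6 4 (ciLocusCodim [1, 1, 2, 2] 4) [(1, standardP 6), (1, standardPc 6 1 1)] := by
  rw [movasati_fiveTuples_rank_eq_ciLocusCodim.2]; exact ivhsRankEq_stdSum

/-- the printed intdim⁴₆(1) [Movasati2016Periods, Thm. 13] (cited evaluation `movasati_fiveTuples_intdim`, m passed as m + 1 = 2). -/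
theorem intdim_6_4_1 : intdim 6 4 2 = 37 := movasati_fiveTuples_intdim.2.2.2.2.2.2.1

/-- EXPLAINED-SMOOTH row: rank [p_{i+j}]([P0] + [Ptwo]) = 37 = intdim⁴₆(1) = rank [M_{P0} ; M_{Ptwo}] — the tangent space of the Hodge locus of
[P0] + [Ptwo] is the intersection of those of V_{P0} and V_{Ptwo} (named locus: the pair locus V_{P0} ∩ V_{Ptwo}). -/
theorem explainedSmooth_6_4_1_twoBlock : ExplainedSmoothRow 6 4 37 [(1, standardP 6), (1, twoBlockP6)] := ivhsRankEq_twoSum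

/-- the same in invariant form: the rank is (intdim 6 4 2).toNat. -/
theorem ivhsRankEq_twoSum_intdim : IvhsRankEq 6 4 (intdim 6 4 2).toNat [(1, standardP 6), (1, twoBlockP6)] := by
  rw [intdim_6_4_1]; exact ivhsRankEq_twoSum

/-! ## Geometry of the pairs: intersections and the complete intersections of the chain
The linear 4-spaces of K⁸ (cones over the projective 3-planes) attached to the four linear cycles, written out from MV18's
P_{a,b} = {x_{b(2e)} = ζ^{1+2a(2e+1)} x_{b(2e+1)}}; elementary linear algebra over any field. -/

section geometry

variable {K : Type*} [Field K] (ζ : K) (x : Fin 8 → K)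

/-- the cone over P0 in K⁸: x₀=ζx₁, x₂=ζx₃, x₄=ζx₅, x₆=ζx₇. -/
def coneP0 : Set (Fin 8 → K) := {x | x 0 = ζ * x 1 ∧ x 2 = ζ * x 3 ∧ x 4 = ζ * x 5 ∧ x 6 = ζ * x 7}

/-- the cone over Ptwo (b = (1 2)(5 6)): x₀=ζx₂, x₁=ζx₃, x₄=ζx₆, x₅=ζx₇. -/
def coneTwoBlock : Set (Fin 8 → K) := {x | x 0 = ζ * x 2 ∧ x 1 = ζ * x 3 ∧ x 4 = ζ * x 6 ∧ x 5 = ζ * x 7}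

/-- the cone over P̌₁ = `standardPc 6 1 1` (twists a₅ = a₇ = 1): x₀=ζx₁, x₂=ζx₃, x₄=ζ³x₅, x₆=ζ³x₇. -/
def coneStd1 : Set (Fin 8 → K) := {x | x 0 = ζ * x 1 ∧ x 2 = ζ * x 3 ∧ x 4 = ζ ^ 3 * x 5 ∧ x 6 = ζ ^ 3 * x 7}

/-- the cone over P3 (b = (5 6)): x₀=ζx₁, x₂=ζx₃, x₄=ζx₆, x₅=ζx₇. -/
def coneMidBlock : Set (Fin 8 → K) := {x | x 0 = ζ * x 1 ∧ x 2 = ζ * x 3 ∧ x 4 = ζ * x 6 ∧ x 5 = ζ * x 7}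

/-- all four cones lie on the Fermat quartic cone Σ x_k⁴ = 0 as soon as ζ⁴ = −1 (so they are 3-planes of the Fermat quartic sixfold). -/
theorem fermat_of_mem_cones (h4 : ζ ^ 4 = -1)
    (hx : x ∈ coneP0 ζ ∪ coneTwoBlock ζ ∪ coneStd1 ζ ∪ coneMidBlock ζ) :
    x 0 ^ 4 + x 1 ^ 4 + x 2 ^ 4 + x 3 ^ 4 + x 4 ^ 4 + x 5 ^ 4 + x 6 ^ 4 + x 7 ^ 4 = 0 := by
  rcases hx with ((⟨h0, h2, h4', h6⟩ | ⟨h0, h1, h4', h5⟩) | ⟨h0, h2, h4', h6⟩) | ⟨h0, h2, h4', h5⟩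
  · rw [h0, h2, h4', h6]; linear_combination (x 1 ^ 4 + x 3 ^ 4 + x 5 ^ 4 + x 7 ^ 4) * h4
  · rw [h0, h1, h4', h5]; linear_combination (x 2 ^ 4 + x 3 ^ 4 + x 6 ^ 4 + x 7 ^ 4) * h4
  · rw [h0, h2, h4', h6]
    linear_combination (x 1 ^ 4 + x 3 ^ 4 + (ζ ^ 8 - ζ ^ 4 + 1) * (x 5 ^ 4 + x 7 ^ 4)) * h4
  · rw [h0, h2, h4', h5]; linear_combination (x 1 ^ 4 + x 3 ^ 4 + x 6 ^ 4 + x 7 ^ 4) * h4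

/-- P0 ∩ Ptwo = ℙ¹: the common solutions in solved form — pivots x₀,x₁,x₂,x₄,x₅,x₆, free coordinates x₃,x₇ (m = 1). -/
theorem inter_P0_twoBlock :
    x ∈ coneP0 ζ ∩ coneTwoBlock ζ ↔
      (x 0 = ζ ^ 2 * x 3 ∧ x 1 = ζ * x 3 ∧ x 2 = ζ * x 3 ∧ x 4 = ζ ^ 2 * x 7 ∧ x 5 = ζ * x 7 ∧ x 6 = ζ * x 7) := by
  constructor
  · rintro ⟨⟨h0, h2, h4, h6⟩, ⟨-, h1, -, h5⟩⟩
    exact ⟨by rw [h0, h1]; ring, h1, h2, by rw [h4, h5]; ring, h5, h6⟩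
  · rintro ⟨h0, h1, h2, h4, h5, h6⟩
    exact ⟨⟨by rw [h0, h1]; ring, h2, by rw [h4, h5]; ring, h6⟩, ⟨by rw [h0, h2]; ring, h1, by rw [h4, h6]; ring, h5⟩⟩

/-- P0 ∩ P̌₁ = ℙ¹ (ζ a primitive 8th root of unity): pivots x₀,x₂,x₄,x₅,x₆,x₇, free x₁,x₃ (m = 1). -/
theorem inter_P0_std (hζ : IsPrimitiveRoot ζ (2 * 4)) :
    x ∈ coneP0 ζ ∩ coneStd1 ζ ↔ (x 0 = ζ * x 1 ∧ x 2 = ζ * x 3 ∧ x 4 = 0 ∧ x 5 = 0 ∧ x 6 = 0 ∧ x 7 = 0) := by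
  have hz0 : ζ ≠ 0 := hζ.ne_zero (by norm_num)
  have hz2 : ζ ^ 2 ≠ 1 := hζ.pow_ne_one_of_pos_of_lt (by norm_num) (by norm_num)
  have hne : ζ - ζ ^ 3 ≠ 0 := by
    intro h
    have h' : ζ * (1 - ζ ^ 2) = 0 := by linear_combination h
    rcases mul_eq_zero.1 h' with h'' | h''
    · exact hz0 h''
    · exact hz2 (by linear_combination -h'')
  have cancel : ∀ t : K, (ζ - ζ ^ 3) * t = 0 → t = 0 := fun t ht => (mul_eq_zero.1 ht).resolve_left hne
  constructor
  · rintro ⟨⟨h0, h2, h4, h6⟩, ⟨-, -, h4', h6'⟩⟩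
    have h5 : x 5 = 0 := cancel _ (by linear_combination h4' - h4)
    have h7 : x 7 = 0 := cancel _ (by linear_combination h6' - h6)
    exact ⟨h0, h2, by rw [h4, h5, mul_zero], h5, by rw [h6, h7, mul_zero], h7⟩
  · rintro ⟨h0, h2, h4, h5, h6, h7⟩
    exact ⟨⟨h0, h2, by rw [h4, h5, mul_zero], by rw [h6, h7, mul_zero]⟩, ⟨h0, h2, by rw [h4, h5, mul_zero], by rw [h6, h7, mul_zero]⟩⟩

/-- P0 ∩ P3 = ℙ²: pivots x₀,x₂,x₄,x₅,x₆, free x₁,x₃,x₇ (m = 2 = n/2 − 1). -/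
theorem inter_P0_mid :
    x ∈ coneP0 ζ ∩ coneMidBlock ζ ↔ (x 0 = ζ * x 1 ∧ x 2 = ζ * x 3 ∧ x 4 = ζ ^ 2 * x 7 ∧ x 5 = ζ * x 7 ∧ x 6 = ζ * x 7) := by
  constructor
  · rintro ⟨⟨h0, h2, h4, h6⟩, ⟨-, -, -, h5⟩⟩
    exact ⟨h0, h2, by rw [h4, h5]; ring, h5, h6⟩
  · rintro ⟨h0, h2, h4, h5, h6⟩
    exact ⟨⟨h0, h2, by rw [h4, h5]; ring, h6⟩, ⟨h0, h2, by rw [h4, h6]; ring, h5⟩⟩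

/-- P3 ∩ Ptwo = ℙ²: pivots x₀,x₁,x₂,x₄,x₅, free x₃,x₆,x₇ (m = 2). -/
theorem inter_mid_twoBlock :
    x ∈ coneMidBlock ζ ∩ coneTwoBlock ζ ↔ (x 0 = ζ ^ 2 * x 3 ∧ x 1 = ζ * x 3 ∧ x 2 = ζ * x 3 ∧ x 4 = ζ * x 6 ∧ x 5 = ζ * x 7) := by
  constructor
  · rintro ⟨⟨h0, h2, h4, h5⟩, ⟨-, h1, -, -⟩⟩
    exact ⟨by rw [h0, h1]; ring, h1, h2, h4, h5⟩
  · rintro ⟨h0, h1, h2, h4, h5⟩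
    exact ⟨⟨by rw [h0, h1]; ring, h2, h4, h5⟩, ⟨by rw [h0, h2]; ring, h1, h4, h5⟩⟩

/-- P0 ∪ P3 is the complete intersection of type (1,1,1,2): two common linear forms, the linear form x₄ − ζx₅ − ζx₆ + ζ²x₇ and the quadric
(x₆ − ζx₇)(x₅ − ζx₇). -/
theorem union_P0_mid_ci :
    x ∈ coneP0 ζ ∪ coneMidBlock ζ ↔
      (x 0 = ζ * x 1 ∧ x 2 = ζ * x 3 ∧ x 4 - ζ * x 5 - ζ * x 6 + ζ ^ 2 * x 7 = 0 ∧ (x 6 - ζ * x 7) * (x 5 - ζ * x 7) = 0) := by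
  constructor
  · rintro (⟨h0, h2, h4, h6⟩ | ⟨h0, h2, h4, h5⟩)
    · exact ⟨h0, h2, by rw [h4, h6]; ring, by rw [h6]; ring⟩
    · exact ⟨h0, h2, by rw [h4, h5]; ring, by rw [h5]; ring⟩
  · rintro ⟨h0, h2, hl, hq⟩
    rcases mul_eq_zero.1 hq with h | h
    · have h6 : x 6 = ζ * x 7 := by linear_combination h
      exact Or.inl ⟨h0, h2, by linear_combination hl + ζ * h6, h6⟩
    · have h5 : x 5 = ζ * x 7 := by linear_combination h
      exact Or.inr ⟨h0, h2, by linear_combination hl + ζ * h5, h5⟩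

/-- P3 ∪ Ptwo is the complete intersection of type (1,1,1,2): two common linear forms, the linear form x₀ − ζx₁ − ζx₂ + ζ²x₃ and the quadric
(x₂ − ζx₃)(x₁ − ζx₃). -/
theorem union_mid_twoBlock_ci :
    x ∈ coneMidBlock ζ ∪ coneTwoBlock ζ ↔
      (x 4 = ζ * x 6 ∧ x 5 = ζ * x 7 ∧ x 0 - ζ * x 1 - ζ * x 2 + ζ ^ 2 * x 3 = 0 ∧ (x 2 - ζ * x 3) * (x 1 - ζ * x 3) = 0) := by
  constructor
  · rintro (⟨h0, h2, h4, h5⟩ | ⟨h0, h1, h4, h5⟩)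
    · exact ⟨h4, h5, by rw [h0, h2]; ring, by rw [h2]; ring⟩
    · exact ⟨h4, h5, by rw [h0, h1]; ring, by rw [h1]; ring⟩
  · rintro ⟨h4, h5, hl, hq⟩
    rcases mul_eq_zero.1 hq with h | h
    · have h2 : x 2 = ζ * x 3 := by linear_combination h
      exact Or.inl ⟨by linear_combination hl + ζ * h2, h2, h4, h5⟩
    · have h1 : x 1 = ζ * x 3 := by linear_combination h
      exact Or.inr ⟨by linear_combination hl + ζ * h1, h1, h4, h5⟩

end geometry

/-! ## Conjecture 5 at (6,4,1) and its refutation -/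

/-- Movasati's CONJECTURE 5 [cite: Movasati2016Periods, §6 Conj. 5] — "The number H^d_n(m) := rank [p_{i+j}]([P^{n/2}] + [P̌^{n/2}]),
P^{n/2} ∩ P̌^{n/2} = ℙ^m, depends only on d, n, m and not the choice of P^{n/2}, P̌^{n/2}" — INSTANTIATED at (n,d,m) = (6,4,1) for the two pairs
(P0, Ptwo) and (P0, P̌₁) of 3-planes of the Fermat quartic sixfold, both meeting in a ℙ¹ (`inter_P0_twoBlock`, `inter_P0_std`): the two period
matrices (schema normalisation, any characteristic-0 field with a primitive 8th root ζ) have the same rank. A CONSEQUENCE of the printed conjecture,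
typed by the cell (not a printed statement); refuted below. -/
@[conjecture] def movasatiConjecture5_at_6_4_1 : Prop :=
  ∀ (K : Type) [Field K] [CharZero K] (ζ : K), IsPrimitiveRoot ζ (2 * 4) →
    (ivhsMatrix 6 4 ζ [(1, standardP 6), (1, twoBlockP6)]).rank =
      (ivhsMatrix 6 4 ζ [(1, standardP 6), (1, standardPc 6 1 1)]).rank

/-- REFUTATION of Conjecture 5 at (6,4,1): at ζ = e^{2πi/8} ∈ ℂ the two-block pair has rank 37 (`ivhsRankEq_twoSum`) and the standard pair 36
(`ivhsRankEq_stdSum` = the proved census row `fiveTuple_6_4_1`). -/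
@[refutes] theorem movasatiConjecture5_at_6_4_1_false : ¬ movasatiConjecture5_at_6_4_1 := by
  intro h
  have hζ := Complex.isPrimitiveRoot_exp (2 * 4) (by norm_num)
  have h37 := ivhsRankEq_twoSum ℂ _ hζ
  have h36 := ivhsRankEq_stdSum ℂ _ hζ
  have := h ℂ _ hζ
  rw [h37, h36] at this
  exact absurd this (by norm_num)

/-- the same two numbers side by side: the rank of the two-block pair exceeds the printed / standard value H⁴₆(1) = 36 by one. -/
theorem twoBlock_rank_eq_std_rank_add_one :
    ∀ (K : Type) [Field K] [CharZero K] (ζ : K), IsPrimitiveRoot ζ (2 * 4) →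
      (ivhsMatrix 6 4 ζ [(1, standardP 6), (1, twoBlockP6)]).rank =
        (ivhsMatrix 6 4 ζ [(1, standardP 6), (1, standardPc 6 1 1)]).rank + 1 := by
  intro K _ _ ζ hζ
  rw [ivhsRankEq_twoSum K ζ hζ, ivhsRankEq_stdSum K ζ hζ]

end Summit.HodgeConjecture.HodgeConjecture.HodgeLocus.Census.QuarticTwoBlock
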